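import Summits.SmoothPoincare4.SmoothPoincare4.Theses.WeakReductionDescent
import Literature.Topology.FourManifolds.CircleSurgeryDichotomy
import Literature.Topology.FourManifolds.CircleSurgerySymmetries
import Literature.Topology.FourManifolds.SphereFourCircleSurgery
import Literature.Topology.FourManifolds.SmoothEmbeddingCriteria
import Literature.Topology.FourManifolds.PalaisBallComplement

/-!
# Crux `WeakReductionReduces` (stmt-SmoothPoincare4-17908), line `loop_dichotomy`, stub L₃ —
# auxiliary file 1: the END-GAME of `stub_loopFromGenusThree`, proved unconditionally

Stub L₃ (`stub_loopFromGenusThree`): a smooth homotopy 4-sphere `M` obtained by surgery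
(`Literature.Topology.FourManifolds.IsCircleSurgery`, either framing) on a smoothly embedded loop
`ℓ` in a closed smooth 4-manifold `X` carrying a GK-trisection of genus `≤ 3` is diffeomorphic to
`S⁴`.  Its proof sketch (Aranda–Zupan 2025 §5/§6 one rung up) ends in the END-GAME

> once `X ≅ S¹ × S³` (Meier–Schirmer–Zupan 2016, Thm. 1.2, with `χ(X) = 0`) and `ℓ` is homotopic
> to the fibre circle `S¹ × {pt}` or to its reverse (`π₁(M) = 1`), the surgery is one of the two
> surgeries on `S¹ × {pt} ⊂ S¹ × S³`, both of which give `S⁴` (Pao 1977: `S₁ ≅ S′₁ ≅ S⁴`;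
> Aranda–Zupan 2025, §2 p. 7: "When `p = 1`, we have that `S₁` and `S′₁` …").

This file PROVES the end-game, with no named fact, from theorems of the tree:

* `helper_loopSurgery_circleProdSphereThree_sphereFour` (registered helper of the crux item):
  for a closed smooth `X` (charted on `ℝ⁴`), a diffeomorphism `Φ : X ≅ S¹ × S³` onto Mathlib's
  product manifold `𝕊¹ × 𝕊³` (model `(𝓡 1).prod (𝓡 3)`), a smoothly embedded loop
  `ℓ : C(𝕊¹, X)` with `Φ ∘ ℓ` homotopic to `u ↦ (u, N)` or to `u ↦ (ū, N)`, and any smooth `M`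
  with `IsCircleSurgery (𝓡 4) (𝓡 4) X M ℓ`: `M ≅ S⁴`.

Proof.  (1) Whitney's theorem (`isSmoothlyIsotopic_circle_of_homotopic`, PROVED) and the isotopy
extension theorem (`isAmbientIsotopic_of_isSmoothlyIsotopic_euclidean`, PROVED) move `ℓ` onto the
model circle `c₀ = Φ⁻¹ ∘ (u ↦ (u, N))` (resp. `c₀ ∘ conj`), and the surgery presentation moves
with it (`IsCircleSurgery.map_diffeomorph`; `IsCircleSurgery.of_comp_circleConj` disposes of the
reversed parametrisation).  (2) `M` is then the surgery of `X` along SOME tube `ν` of `c₀`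
(uniqueness of gluings, `IsOpenGluing.nonempty_diffeomorph`), and a circle in a `4`-manifold has
at most two framings (`CircleNbhd.nonempty_diffeomorph_surgered_or_twist`, PROVED): `ν.Surgered`
is `ν₀.Surgered` or `(ν₀.linTwist twist).Surgered` for the model tube `ν₀ = Φ⁻¹ ∘ tubeNbhd`.
(3) Both are `S⁴`: the two gluings of `S⁴` from `(S¹ × S³) ∖ (S¹ × N)` and `D̊² × S²` along the
relations of `tubeNbhd` and of the twisted tube `tubeNbhdTwist`
(`isOpenGluing_circleSurgeryRel_tubeNbhd(_Twist)_sphereFour`, PROVED, `SphereFourCircleSurgery`)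
are transported to `X` along `Φ⁻¹` — this needs a CROSS-MODEL transport of tubes and of
circle-surgery gluings (`exists_circleNbhd_comp`, `IsOpenGluing.circleSurgeryRel_comp`), built
here on a cross-model composition lemma for OPEN smooth embeddings
(`isSmoothEmbedding_comp_of_isOpen_range`, via the tree's chart criterion
`isSmoothEmbedding_of_openPartialHomeomorph`; Mathlib has no composition of smooth embeddings) —
and `ν₀.linTwist twist = Φ⁻¹ ∘ tubeNbhdTwist` because the twist loop of
`CircleFramingClassification` is the rotation `rotThree` used by the twisted tube
(`twist_toFun_apply`).

The remaining (conditional) assembly of L₃ from this end-game and the named facts it genuinely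
needs (MSZ16 Thm. 1.2 in the `χ = 0` range; `χ` of a circle surgery; `π₁` of a circle surgery;
loops in `S¹ × S³`) is the sibling auxiliary file 2.

## References

* P. S. Pao, *The topology structure of 4-manifolds with effective torus actions. I*, Trans. AMS
  227 (1977), doi:10.2307/1997462. [Pao1977]
* R. Aranda, A. Zupan, arXiv:2503.04607 (2025), §2 (p. 7), §5–§6. [ArandaZupan2025]
* R. E. Gompf, A. I. Stipsicz, *4-Manifolds and Kirby Calculus* (1999), §5.2. [GompfStipsiczGSM1999]
* J. Milnor, *Lectures on the h-cobordism theorem* (1965), Thm. 8.4 + Remark, Thm. 5.8.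
  [MilnorHCobordism1965]
* J. M. Lee, *Introduction to Smooth Manifolds* (2013), Prop. 5.2, Thm. 4.14 (open embeddings).
-/

-- the registered namespace `Summit.SmoothPoincare4.SmoothPoincare4.Theorems…` repeats a component
set_option linter.dupNamespace false

noncomputable section

open scoped Manifold ContDiff Topology ContinuousMap
open Set Function
open Literature.Topology.FourManifolds

namespace Summit.SmoothPoincare4.SmoothPoincare4.Theorems.WeakReductionReduces.LoopDichotomy

/-! ### Cross-model composition of open smooth embeddings -/

section OpenEmb

variable {EA HA EB HB EC HC : Type*}
  [NormedAddCommGroup EA] [NormedSpace ℝ EA] [TopologicalSpace HA]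
  [NormedAddCommGroup EB] [NormedSpace ℝ EB] [TopologicalSpace HB]
  [NormedAddCommGroup EC] [NormedSpace ℝ EC] [TopologicalSpace HC]
  {IA : ModelWithCorners ℝ EA HA} {IB : ModelWithCorners ℝ EB HB} {IC : ModelWithCorners ℝ EC HC}
  {A : Type*} [TopologicalSpace A] [ChartedSpace HA A]
  {B : Type*} [TopologicalSpace B] [ChartedSpace HB B]
  {C : Type*} [TopologicalSpace C] [ChartedSpace HC C]

/-- **The composition of two OPEN smooth embeddings is an open smooth embedding**, for
boundaryless source and target with ANY models on vector spaces of equal dimension (`L`): the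
composite is a globally defined partial diffeomorphism (the inverses are smooth on the ranges,
`contMDiffOn_symm_of_isSmoothEmbedding`), hence a smooth embedding by the tree's chart
criterion `isSmoothEmbedding_of_openPartialHomeomorph` (Lee 2013, Prop. 5.2).  Mathlib leaves
`Manifold.IsSmoothEmbedding.comp` as `proof_wanted`; the tree's composition lemmas are same-model.
[folklore] -/
theorem isSmoothEmbedding_comp_of_isOpen_range [IA.Boundaryless] [IC.Boundaryless]
    [IsManifold IA ∞ A] [IsManifold IC ∞ C] [Nonempty A] [Nonempty B]
    {f : A → B} {g : B → C} (hf : Manifold.IsSmoothEmbedding IA IB ∞ f) (hfo : IsOpen (range f))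
    (hg : Manifold.IsSmoothEmbedding IB IC ∞ g) (hgo : IsOpen (range g)) (L : EA ≃L[ℝ] EC) :
    Manifold.IsSmoothEmbedding IA IC ∞ (g ∘ f) := by
  have hfO : Topology.IsOpenEmbedding f := ⟨hf.isEmbedding, hfo⟩
  have hgO : Topology.IsOpenEmbedding g := ⟨hg.isEmbedding, hgo⟩
  set Φf := hfO.toOpenPartialHomeomorph f with hΦf
  set Φg := hgO.toOpenPartialHomeomorph g with hΦg
  set Φ := Φf.trans Φg with hΦ
  have hsrc : Φ.source = univ := by
    simp [hΦ, hΦf, hΦg]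
  have hcoe : (Φ : A → C) = g ∘ f := by
    simp [hΦ, hΦf, hΦg, OpenPartialHomeomorph.coe_trans]
  have h1 : ContMDiffOn IA IC ∞ Φ Φ.source := by
    rw [hcoe]; exact (hg.contMDiff.comp hf.contMDiff).contMDiffOn
  have hfinv : ContMDiffOn IB IA ∞ Φf.symm (range f) :=
    contMDiffOn_symm_of_isSmoothEmbedding hf hfO
  have hginv : ContMDiffOn IC IB ∞ Φg.symm (range g) :=
    contMDiffOn_symm_of_isSmoothEmbedding hg hgO
  have h2 : ContMDiffOn IC IA ∞ Φ.symm Φ.target := by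
    rw [hΦ, OpenPartialHomeomorph.coe_trans_symm, OpenPartialHomeomorph.trans_target]
    refine hfinv.comp (hginv.mono ?_) ?_
    · intro z hz; simpa [hΦg] using hz.1
    · intro z hz; simpa [hΦf] using hz.2
  have := isSmoothEmbedding_of_openPartialHomeomorph Φ hsrc h1 h2 L
  rwa [hcoe] at this

end OpenEmb

/-! ### Cross-model transport of tubes of circles and of circle-surgery gluings -/

section CircleTransport

variable {EX HX EY HY : Type*} [NormedAddCommGroup EX] [NormedSpace ℝ EX] [TopologicalSpace HX]
  [NormedAddCommGroup EY] [NormedSpace ℝ EY] [TopologicalSpace HY]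
  {IX : ModelWithCorners ℝ EX HX} {IY : ModelWithCorners ℝ EY HY}
  [IX.Boundaryless] [IY.Boundaryless]
  {X : Type*} [TopologicalSpace X] [ChartedSpace HX X] [IsManifold IX ∞ X]
  {Y : Type*} [TopologicalSpace Y] [ChartedSpace HY Y] [IsManifold IY ∞ Y]

omit [IY.Boundaryless] [IsManifold IY ∞ Y] in
/-- A point `ν (u, w)` of a tube lies on its core circle iff `w = 0`. [folklore] -/
theorem apply_mem_range_iff {c : (Metric.sphere (0 : EuclideanSpace ℝ (Fin 2)) 1) → Y}
    (ν : CircleNbhd IY c) {u : (Metric.sphere (0 : EuclideanSpace ℝ (Fin 2)) 1)}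
    {w : EuclideanSpace ℝ (Fin 3)} :
    ν.toFun (u, w) ∈ range c ↔ w = 0 := by
  constructor
  · rintro ⟨u', h⟩
    rw [← ν.apply_zero] at h
    exact (congrArg Prod.snd (ν.isSmoothEmbedding.isEmbedding.injective h)).symm
  · rintro rfl
    exact ⟨u, (ν.apply_zero u).symm⟩

/-- **Transport of a tubular neighbourhood of a circle along a diffeomorphism between manifolds
with possibly different boundaryless models** (`L₃`, `L` identify the model vector spaces):
`Ψ ∘ ν` is (the underlying map of) a tube of `Ψ ∘ c` (the tree's `CircleNbhd.map` is the
same-model case).  Stated as an existence so that no definition is introduced.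
[cite: GompfStipsiczGSM1999, §5.2] -/
theorem exists_circleNbhd_comp {c : (Metric.sphere (0 : EuclideanSpace ℝ (Fin 2)) 1) → Y}
    (ν : CircleNbhd IY c) (Ψ : Y ≃ₘ⟮IY, IX⟯ X)
    (L₃ : ((EuclideanSpace ℝ (Fin 1)) × (EuclideanSpace ℝ (Fin 3))) ≃L[ℝ] EX) (L : EY ≃L[ℝ] EX) :
    ∃ ν' : CircleNbhd IX (Ψ ∘ c), ν'.toFun = Ψ ∘ ν.toFun := by
  haveI : Nonempty Y := ⟨c (Classical.arbitrary _)⟩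
  have hr : range (Ψ : Y → X) = univ :=
    Set.eq_univ_of_forall fun x ↦ ⟨Ψ.symm x, Ψ.apply_symm_apply x⟩
  refine ⟨{ toFun := Ψ ∘ ν.toFun
            isSmoothEmbedding := ?_
            isOpen_range := ?_
            apply_zero := fun u ↦ by simp only [Function.comp_apply, ν.apply_zero] }, rfl⟩
  · refine isSmoothEmbedding_comp_of_isOpen_range ν.isSmoothEmbedding ν.isOpen_range
      (isSmoothEmbedding_diffeomorph_of_boundaryless Ψ L) ?_ L₃
    rw [hr]; exact isOpen_univ
  · rw [Set.range_comp]
    exact Ψ.toHomeomorph.isOpenMap _ ν.isOpen_range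

variable [T2Space X] [T2Space Y]
  {EP HP : Type*} [NormedAddCommGroup EP] [NormedSpace ℝ EP] [TopologicalSpace HP]
  {IP : ModelWithCorners ℝ EP HP} [IP.Boundaryless]
  {P : Type*} [TopologicalSpace P] [ChartedSpace HP P] [IsManifold IP ∞ P]

/-- **Transport of a circle-surgery gluing along a cross-model diffeomorphism of the ambient
manifold**: if `P` is glued from `Y ∖ c` and `D̊² × S²` along the surgery relation of the tube
`ν`, then `P` is glued from `X ∖ Ψ(c)` and `D̊² × S²` along the relation of any tube `ν'` of
`Ψ ∘ c` with underlying map `Ψ ∘ ν` — precompose the embedding of the complement with the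
restriction of `Ψ⁻¹` (`opensCongr`); the relation is unchanged because both tubes carry the same
polar coordinates (Kosinski 1993, VI.1, transport of gluings; the tree's same-model
`IsCircleSurgery.map_diffeomorph`). [cite: Kosinski1993, Ch. VI §1, proof of Thm (1.1)] -/
theorem IsOpenGluing.circleSurgeryRel_comp
    {c : (Metric.sphere (0 : EuclideanSpace ℝ (Fin 2)) 1) → Y}
    (ν : CircleNbhd IY c) (Ψ : Y ≃ₘ⟮IY, IX⟯ X) (L : EY ≃L[ℝ] EX) (LP : EX ≃L[ℝ] EP)
    (ν' : CircleNbhd IX (Ψ ∘ c)) (hν' : ν'.toFun = Ψ ∘ ν.toFun)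
    (h : IsOpenGluing IY (𝓘(ℝ, EuclideanSpace ℝ (Fin 2)).prod (𝓡 2)) IP (A := ↥ν.complement)
      (B := ↥discTimesSphere) (P := P) (circleSurgeryRel ν)) :
    IsOpenGluing IX (𝓘(ℝ, EuclideanSpace ℝ (Fin 2)).prod (𝓡 2)) IP (A := ↥ν'.complement)
      (B := ↥discTimesSphere) (P := P) (circleSurgeryRel ν') := by
  obtain ⟨jA, jB, hA, hAo, hB, hBo, hU, hR⟩ := h
  -- the complements correspond under `Ψ⁻¹`
  let κ : ↥ν'.complement ≃ₘ⟮IX, IY⟯ ↥ν.complement :=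
    opensCongr Ψ.symm _ _ fun x ↦ by
      simp only [CircleNbhd.mem_complement_iff, Set.mem_range, Function.comp_apply, not_exists]
      constructor
      · intro h u hu; exact h u (by rw [hu, Diffeomorph.apply_symm_apply])
      · intro h u hu; exact h u (by rw [← hu, Diffeomorph.symm_apply_apply])
  have hne : Nonempty ↥ν'.complement := by
    refine ⟨⟨ν'.toFun (Classical.arbitrary _, EuclideanSpace.single 0 1), ?_⟩⟩
    rw [CircleNbhd.mem_complement_iff, apply_mem_range_iff]
    simp
  haveI : Nonempty ↥ν.complement := ⟨κ (Classical.arbitrary _)⟩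
  have hsurj : Function.Surjective (κ : _ → ↥ν.complement) := κ.surjective
  refine ⟨jA ∘ κ, jB, ?_, ?_, hB, hBo, ?_, fun a b ↦ ?_⟩
  · refine isSmoothEmbedding_comp_of_isOpen_range
      (isSmoothEmbedding_diffeomorph_of_boundaryless κ L.symm) ?_ hA hAo LP
    rw [hsurj.range_eq]; exact isOpen_univ
  · rwa [hsurj.range_comp]
  · rwa [hsurj.range_comp]
  · rw [Function.comp_apply, hR]
    simp only [circleSurgeryRel, hν', Function.comp_apply]
    refine exists_congr fun u ↦ exists_congr fun t ↦ and_congr_right fun _ ↦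
      and_congr_right fun _ ↦ ?_
    have hκa : ((κ a : ↥ν.complement) : Y) = Ψ.symm (a : X) := rfl
    rw [hκa]
    constructor
    · intro h1; rw [← h1, Diffeomorph.apply_symm_apply]
    · intro h1; rw [h1, Diffeomorph.symm_apply_apply]

end CircleTransport

/-! ### The end-game: both surgeries on the fibre circle of a copy of `S¹ × S³` give `S⁴` -/

section EndGame

open SphereFourSurgery GluckUnknot

/-- Two tubular neighbourhoods of the same circle with the same underlying map are equal.
[folklore] -/
theorem circleNbhd_eq_of_toFun_eq {EX HX : Type*} [NormedAddCommGroup EX] [NormedSpace ℝ EX]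
    [TopologicalSpace HX] {IX : ModelWithCorners ℝ EX HX} {X : Type*} [TopologicalSpace X]
    [ChartedSpace HX X] {c : (Metric.sphere (0 : EuclideanSpace ℝ (Fin 2)) 1) → X}
    {ν ν' : CircleNbhd IX c} (h : ν.toFun = ν'.toFun) : ν = ν' := by
  cases ν; cases ν'; cases h; rfl

/-- The twist loop of `CircleFramingClassification` (one full turn of the `(x₀, x₁)`-plane) acts
on `ℝ³` as the rotation `rotThree` of `GluckTwistUnknotProofs` used by the twisted tube
`SphereFourSurgery.tubeNbhdTwist`. [folklore] -/
theorem twist_toFun_apply (u : (Metric.sphere (0 : EuclideanSpace ℝ (Fin 2)) 1))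
    (w : EuclideanSpace ℝ (Fin 3)) :
    OpLoop.twist.toFun u w = rotThree (u : EuclideanSpace ℝ (Fin 2)) w := by
  change matCLM (OpLoop.rotMat (u : EuclideanSpace ℝ (Fin 2))) w =
    rotThree (u : EuclideanSpace ℝ (Fin 2)) w
  rw [matCLM_apply]
  ext i
  rw [mulVecE_apply]
  fin_cases i
  · simp [OpLoop.rotMat, Fin.sum_univ_three]; ring
  · simp [OpLoop.rotMat, Fin.sum_univ_three]
  · simp [OpLoop.rotMat, Fin.sum_univ_three]

/-- **The core circle of a tubular neighbourhood in a smooth `4`-manifold is a smooth embedding**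
(zero section of a product neighbourhood with smooth inverse on its open range; the tree's
`isImmersionAtOfComplement_of_eventuallyEq_prod`, as for `StdChart.isSmoothEmbedding_c`).
[folklore] -/
theorem isSmoothEmbedding_core {X : Type*} [TopologicalSpace X] [T2Space X]
    [ChartedSpace (EuclideanSpace ℝ (Fin 4)) X] [IsManifold (𝓡 4) ∞ X]
    {c : (Metric.sphere (0 : EuclideanSpace ℝ (Fin 2)) 1) → X} (ν : CircleNbhd (𝓡 4) c) :
    Manifold.IsSmoothEmbedding (𝓡 1) (𝓡 4) ∞ c := by
  haveI := Fact.mk (@finrank_euclideanSpace_fin ℝ _ 2)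
  have hO : Topology.IsOpenEmbedding ν.toFun := ⟨ν.isSmoothEmbedding.isEmbedding, ν.isOpen_range⟩
  set T := hO.toOpenPartialHomeomorph ν.toFun with hT
  have hc : c = fun u ↦ T (u, 0) := funext fun u ↦ by
    rw [hT, Topology.IsOpenEmbedding.toOpenPartialHomeomorph_apply, ν.apply_zero]
  have hcont : Continuous c := by
    rw [hc]; exact hO.continuous.comp (by fun_prop)
  have hinj : Injective c := fun u v h ↦ by
    rw [← ν.apply_zero, ← ν.apply_zero] at h
    exact congrArg Prod.fst (hO.injective h)
  refine ⟨Manifold.IsImmersionOfComplement.isImmersion (F := (EuclideanSpace ℝ (Fin 3))) fun u ↦ ?_,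
    (hcont.isClosedEmbedding hinj).isEmbedding⟩
  refine isImmersionAtOfComplement_of_eventuallyEq_prod T ?_ ?_ StdCircleSurgery.tubeLin ?_
    (Filter.EventuallyEq.of_eq hc)
  · rw [hT, Topology.IsOpenEmbedding.toOpenPartialHomeomorph_source]
    exact ν.isSmoothEmbedding.contMDiff.contMDiffOn
  · have := contMDiffOn_symm_of_isSmoothEmbedding ν.isSmoothEmbedding hO
    rw [hT, Topology.IsOpenEmbedding.toOpenPartialHomeomorph_target]
    simpa using this
  · rw [hT, Topology.IsOpenEmbedding.toOpenPartialHomeomorph_source]; exact mem_univ _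

/-- **End-game of L₃ (unconditional): surgery on a loop of a copy of `S¹ × S³` homotopic to the
fibre circle, with either framing, gives `S⁴`.**  Let `X` be a closed smooth `4`-manifold with a
diffeomorphism `Φ : X ≅ S¹ × S³` (Mathlib's product manifold, model `(𝓡 1).prod (𝓡 3)`), `ℓ` a
smoothly embedded loop in `X` such that `Φ ∘ ℓ` is homotopic to the fibre circle `u ↦ (u, N)` or
to its reverse `u ↦ (ū, N)` (`circleConj`), and `M` a smooth `4`-manifold obtained from `X` by
surgery on `ℓ` (`IsCircleSurgery`, ANY tube, i.e. either framing).  Then `M ≅ S⁴`.  Proof: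
Whitney + isotopy extension move `ℓ` to `Φ⁻¹ ∘ (u ↦ (u, N))` and the surgery with it; a circle has
at most two framings (`CircleNbhd.nonempty_diffeomorph_surgered_or_twist`); the two model
surgeries are the transports along `Φ⁻¹` of the two PROVED presentations of `S⁴` as a surgery on
`S¹ × {N} ⊂ S¹ × S³` (`isOpenGluing_circleSurgeryRel_tubeNbhd_sphereFour`, `…Twist…`; Pao 1977,
`S₁ ≅ S′₁ ≅ S⁴`; Kirby 1989 Ch. I §2; Gompf–Stipsicz §5.2), identified by uniqueness of gluings.
[cite: Pao1977, Thm (`S₁ ≅ S'₁ ≅ S⁴`)] [cite: ArandaZupan2025, §2 p. 7]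
[cite: GompfStipsiczGSM1999, §5.2] -/
theorem helper_loopSurgery_circleProdSphereThree_sphereFour :
    ∀ (X : Type) [TopologicalSpace X] [T2Space X] [SecondCountableTopology X] [CompactSpace X] [ChartedSpace (EuclideanSpace ℝ (Fin 4)) X] [IsManifold (𝓡 4) ((⊤ : ℕ∞) : WithTop ℕ∞) X] (Φ : Diffeomorph (𝓡 4) ((𝓡 1).prod (𝓡 3)) X ((Metric.sphere (0 : EuclideanSpace ℝ (Fin 2)) 1) × (Metric.sphere (0 : EuclideanSpace ℝ (Fin 4)) 1)) ((⊤ : ℕ∞) : WithTop ℕ∞)) (ℓ : C((Metric.sphere (0 : EuclideanSpace ℝ (Fin 2)) 1), X)), Manifold.IsSmoothEmbedding (𝓡 1) (𝓡 4) ((⊤ : ℕ∞) : WithTop ℕ∞) ⇑ℓ → ((ContinuousMap.comp ⟨⇑Φ, Φ.continuous⟩ ℓ).Homotopic ((ContinuousMap.id (Metric.sphere (0 : EuclideanSpace ℝ (Fin 2)) 1)).prodMk (ContinuousMap.const (Metric.sphere (0 : EuclideanSpace ℝ (Fin 2)) 1) Literature.Topology.FourManifolds.SphereFourSurgery.northPole))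 ∨ (ContinuousMap.comp ⟨⇑Φ, Φ.continuous⟩ ℓ).Homotopic ((⟨⇑Literature.Topology.FourManifolds.circleConj, Literature.Topology.FourManifolds.circleConj.continuous⟩ : C((Metric.sphere (0 : EuclideanSpace ℝ (Fin 2)) 1), (Metric.sphere (0 : EuclideanSpace ℝ (Fin 2)) 1))).prodMk (ContinuousMap.const (Metric.sphere (0 : EuclideanSpace ℝ (Fin 2)) 1) Literature.Topology.FourManifolds.SphereFourSurgery.northPole))) → ∀ (M : Type) [TopologicalSpace M] [T2Space M] [SecondCountableTopology M] [ChartedSpace (EuclideanSpace ℝ (Fin 4)) M] [IsManifold (𝓡 4) ((⊤ : ℕ∞) : WithTop ℕ∞) M], Literature.Topology.FourManifolds.IsCircleSurgery (𝓡 4) (𝓡 4) X M ⇑ℓ → Nonempty (Diffeomorph (𝓡 4) (𝓡 4) M (Metric.sphere (0 : EuclideanSpace ℝ (Fin 5)) 1) ((⊤ : ℕ∞) : WithTop ℕ∞)) := by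
  intro X _ _ _ _ _ _ Φ ℓ hℓ hhom M _ _ _ _ _ hsurg
  haveI := Fact.mk (@finrank_euclideanSpace_fin ℝ _ 2)
  haveI := Fact.mk (@finrank_euclideanSpace_fin ℝ _ 4)
  -- the model circle and its two tubes, transported to `X`
  set Ψ := Φ.symm with hΨ
  set c₀ : (Metric.sphere (0 : EuclideanSpace ℝ (Fin 2)) 1) → X := Ψ ∘ fibreCircle with hc₀def
  obtain ⟨ν₀, hν₀⟩ :=
    exists_circleNbhd_comp tubeNbhd Ψ StdCircleSurgery.tubeLin StdCircleSurgery.tubeLin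
  obtain ⟨ν₁, hν₁⟩ :=
    exists_circleNbhd_comp tubeNbhdTwist Ψ StdCircleSurgery.tubeLin StdCircleSurgery.tubeLin
  have hc₀ : Manifold.IsSmoothEmbedding (𝓡 1) (𝓡 4) ∞ c₀ := isSmoothEmbedding_core ν₀
  -- Step 1: `M` is also the surgery along the model circle `c₀` (Whitney's isotopy, isotopy
  -- extension, transport of the surgery; the reversed circle by `of_comp_circleConj`)
  have key : ∀ e : C(_, X), Manifold.IsSmoothEmbedding (𝓡 1) (𝓡 4) ∞ ⇑e →
      ℓ.Homotopic e → IsCircleSurgery (𝓡 4) (𝓡 4) X M ⇑e := by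
    intro e he hle
    obtain ⟨F, hF⟩ := isAmbientIsotopic_of_isSmoothlyIsotopic_euclidean (⇑ℓ) (⇑e)
      (isSmoothlyIsotopic_circle_of_homotopic (n := 4) le_rfl ℓ e hℓ he hle)
    have hFe : (F.toDiffeomorph 1 : X → X) ∘ ⇑ℓ = ⇑e := by
      rw [F.coe_toDiffeomorph 1]; exact hF
    have h2 := hsurg.map_diffeomorph (F.toDiffeomorph 1)
    rwa [hFe] at h2
  let Ψc : C(_, X) := ⟨Ψ, Ψ.continuous⟩
  let Φc : C(X, _) := ⟨Φ, Φ.continuous⟩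
  have hback : ∀ g : C(_, _), (Φc.comp ℓ).Homotopic g → ℓ.Homotopic (Ψc.comp g) := by
    intro g hg
    have h1 := (ContinuousMap.Homotopic.refl Ψc).comp hg
    have h2 : Ψc.comp (Φc.comp ℓ) = ℓ := by
      ext1 u; exact Φ.symm_apply_apply (ℓ u)
    rwa [h2] at h1
  have h₀ : IsCircleSurgery (𝓡 4) (𝓡 4) X M c₀ := by
    rcases hhom with h | h
    · exact key (Ψc.comp ((ContinuousMap.id _).prodMk (ContinuousMap.const _ northPole)))
        hc₀ (hback _ h)
    · exact (key (Ψc.comp ((⟨⇑circleConj, circleConj.continuous⟩ : C(_, _)).prodMk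
        (ContinuousMap.const _ northPole))) (hc₀.comp_diffeomorph circleConj)
        (hback _ h)).of_comp_circleConj
  -- Step 2: `M` is the surgery along SOME tube `ν` of `c₀`; compare with the model tube `ν₀`
  obtain ⟨ν, hν⟩ := h₀
  obtain ⟨e₁⟩ := IsOpenGluing.nonempty_diffeomorph hν ν.isOpenGluing_surgered
  -- Step 3: both model surgeries are `S⁴` (Pao; the tree's `SphereFourCircleSurgery`)
  haveI := Fact.mk (@finrank_euclideanSpace_fin ℝ _ 5)
  have hS₀ : Nonempty (ν₀.Surgered ≃ₘ⟮𝓡 4, 𝓡 4⟯ (Metric.sphere (0 : EuclideanSpace ℝ (Fin 5)) 1)) :=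
    IsOpenGluing.nonempty_diffeomorph ν₀.isOpenGluing_surgered
      (IsOpenGluing.circleSurgeryRel_comp tubeNbhd Ψ StdCircleSurgery.tubeLin
        (ContinuousLinearEquiv.refl ℝ (EuclideanSpace ℝ (Fin 4))) ν₀ hν₀
        isOpenGluing_circleSurgeryRel_tubeNbhd_sphereFour)
  have hS₁ : Nonempty (ν₁.Surgered ≃ₘ⟮𝓡 4, 𝓡 4⟯ (Metric.sphere (0 : EuclideanSpace ℝ (Fin 5)) 1)) :=
    IsOpenGluing.nonempty_diffeomorph ν₁.isOpenGluing_surgered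
      (IsOpenGluing.circleSurgeryRel_comp tubeNbhdTwist Ψ StdCircleSurgery.tubeLin
        (ContinuousLinearEquiv.refl ℝ (EuclideanSpace ℝ (Fin 4))) ν₁ hν₁
        isOpenGluing_circleSurgeryRel_tubeNbhdTwist_sphereFour)
  have h01 : ν₀.linTwist OpLoop.twist = ν₁ :=
    circleNbhd_eq_of_toFun_eq (funext fun q ↦ by
      obtain ⟨u, w⟩ := q
      rw [CircleNbhd.linTwist_apply, hν₀, hν₁, Function.comp_apply, Function.comp_apply,
        twist_toFun_apply, tubeNbhdTwist_apply])
  rcases CircleNbhd.nonempty_diffeomorph_surgered_or_twist ν₀ ν with h2 | h2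
  · obtain ⟨e₂⟩ := h2
    exact ⟨e₁.trans (e₂.trans hS₀.some)⟩
  · rw [h01] at h2
    obtain ⟨e₂⟩ := h2
    exact ⟨e₁.trans (e₂.trans hS₁.some)⟩

end EndGame

end Summit.SmoothPoincare4.SmoothPoincare4.Theorems.WeakReductionReduces.LoopDichotomy

end
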